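import Summits.QuantumFields.YangMills.Theorems.FlatTubeReductionSymmetricKernelPrelimVar
import HarnessLib

/-!
# The SYMMETRIC KERNEL RATIO LEMMA, MOMENT FORM: `|F₁₂F₂₁ − F₁₁F₂₂| ≤ (ξ + 40v)·F₁₁F₂₂` where the second-order term is measured by TILTED SECOND MOMENTS `v` of the exponent
# differences (the pointwise bound `η ≤ 1` is kept only for exponential control and no longer enters the rate)
# (route `FlatTubeReduction`, crux K1 `NearFlatRatioLaw` stmt-QuantumFields-24720; seat `ym-line-ftr-p1` g15; rate twin «ratepack-v4 / Gaussian fibres, moment-based near pair»;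
# R2b1 RECORD rung — no summit statement is proved here)

WHY (memo `Cruxes/NearFlatRatioLaw/Lines/ratepack-v4-moments-g15.md` §3(a)).  The sup-form `…SymmetricKernelRatio.symmetric_kernel_ratio` (rate `ξ + 120η²`, `η` = sup of the
exponent differences on the profile support) forces the fibre profile to have support radius `β^{-1/2}` exactly: at the radius `β^{-1/2}√log β` that the (B-OD)-rate brick needs
(an `O(λ_b)`-quasimode profile) the sup picks up `log β` and `η²` loses `log²β` against the budget `λ_b²`.  The logs live in suprema, not in moments: this file re-proves the
lemma with the second-order term controlled by `v ≥ ⟨A²⟩_{ρ₁}/F₁₁, ⟨A'²⟩_{ρ₂}/F₂₂, ⟨Z²⟩_{ρ₁}/F₁₁` (`A = E₁₂ − E₁₁`, `A' = E₂₁ − E₂₂`, `Z = E₂₂ − E₁₁`, `ρ₁ = qe^{E₁₁}`,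
`ρ₂ = qe^{E₂₂}`), keeping `|·| ≤ η ≤ 1` pointwise only inside `e^{±2η} ≤ e²`.
* ★★★ `symmetric_kernel_ratio_var` (prelims `exp_moment_first_order_var`, `exp_tilt_covariance_var`, `sq_integral_mul_le` in `…SymmetricKernelPrelimVar`).
HONEST FRAMING: elementary real analysis (no physics); the first atom of the moment-based repair of the rate twin's near-pair step; femto rung R2b1 (RECORD label); not infinite
volume, not a gap, not Clay.  No defs, no named facts, no `sorry`.
-/

set_option autoImplicit false

noncomputable section

open MeasureTheory Real

namespace Summit.QuantumFields.YangMills.Theorems.FemtoTransferGap.RateTube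

variable {X : Type*} [MeasurableSpace X] {μ : Measure X}

/-! ## §2 ★★★ The moment form of the symmetric kernel ratio lemma -/

set_option maxHeartbeats 800000 in
/-- ★★★ **SYMMETRIC KERNEL RATIO LEMMA, MOMENT FORM.**  `q ≥ 0`, exponents `E₁₁, E₁₂, E₂₁, E₂₂` (all measurable), `F_{ij} = ∫ q e^{E_{ij}}` finite; on `{q ≠ 0}`: `|E₁₂ − E₁₁|, |E₂₁ − E₁₁|, |E₁₂ − E₂₂|,
|E₂₁ − E₂₂| ≤ η ≤ 1` and `|E₁₂ + E₂₁ − E₁₁ − E₂₂| ≤ ξ`; SYMMETRY: `∫ q e^{E₁₁}(E₁₂ − E₂₁) = 0 = ∫ q e^{E₂₂}(E₁₂ − E₂₁)`.  MOMENTS: `∫qe^{E₁₁}(E₁₂−E₁₁)² ≤ vF₁₁`, `∫qe^{E₂₂}(E₂₁−E₂₂)² ≤ vF₂₂`, `∫qe^{E₁₁}(E₂₂−E₁₁)² ≤ vF₁₁`, `0 ≤ v ≤ 1`.  Then `|F₁₂F₂₁ − F₁₁F₂₂| ≤ (ξ + 40v)·F₁₁F₂₂`.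
[folklore] -/
theorem symmetric_kernel_ratio_var {q E₁₁ E₁₂ E₂₁ E₂₂ : X → ℝ} (hq0 : ∀ x, 0 ≤ q x) (hqm : Measurable q)
    (hm₁₁ : Measurable E₁₁) (hm₁₂ : Measurable E₁₂) (hm₂₁ : Measurable E₂₁) (hm₂₂ : Measurable E₂₂)
    (hI₁₁ : Integrable (fun x => q x * Real.exp (E₁₁ x)) μ) (hI₁₂ : Integrable (fun x => q x * Real.exp (E₁₂ x)) μ)
    (hI₂₁ : Integrable (fun x => q x * Real.exp (E₂₁ x)) μ) (hI₂₂ : Integrable (fun x => q x * Real.exp (E₂₂ x)) μ)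
    {η ξ : ℝ} (hη0 : 0 ≤ η) (hη1 : η ≤ 1)
    (hb : ∀ x, q x ≠ 0 → |E₁₂ x - E₁₁ x| ≤ η ∧ |E₂₁ x - E₁₁ x| ≤ η ∧ |E₁₂ x - E₂₂ x| ≤ η ∧ |E₂₁ x - E₂₂ x| ≤ η ∧ |E₁₂ x + E₂₁ x - E₁₁ x - E₂₂ x| ≤ ξ)
    (hS₁ : ∫ x, q x * Real.exp (E₁₁ x) * (E₁₂ x - E₂₁ x) ∂μ = 0) (hS₂ : ∫ x, q x * Real.exp (E₂₂ x) * (E₁₂ x - E₂₁ x) ∂μ = 0)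
    {v : ℝ} (hv0 : 0 ≤ v) (hv1 : v ≤ 1)
    (hvA : ∫ x, q x * Real.exp (E₁₁ x) * (E₁₂ x - E₁₁ x) ^ 2 ∂μ ≤ v * ∫ x, q x * Real.exp (E₁₁ x) ∂μ)
    (hvA' : ∫ x, q x * Real.exp (E₂₂ x) * (E₂₁ x - E₂₂ x) ^ 2 ∂μ ≤ v * ∫ x, q x * Real.exp (E₂₂ x) ∂μ)
    (hvZ : ∫ x, q x * Real.exp (E₁₁ x) * (E₂₂ x - E₁₁ x) ^ 2 ∂μ ≤ v * ∫ x, q x * Real.exp (E₁₁ x) ∂μ) :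
    |(∫ x, q x * Real.exp (E₁₂ x) ∂μ) * (∫ x, q x * Real.exp (E₂₁ x) ∂μ) - (∫ x, q x * Real.exp (E₁₁ x) ∂μ) * (∫ x, q x * Real.exp (E₂₂ x) ∂μ)| ≤
      (ξ + 40 * v) * ((∫ x, q x * Real.exp (E₁₁ x) ∂μ) * (∫ x, q x * Real.exp (E₂₂ x) ∂μ)) := by
  have _ := hqm
  -- opaque names (no `set`: keeps `rfl`/`linarith` defeq checks cheap)
  obtain ⟨ρ₁, hρ₁⟩ : ∃ ρ : X → ℝ, ρ = fun x => q x * Real.exp (E₁₁ x) := ⟨_, rfl⟩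
  obtain ⟨ρ₂, hρ₂⟩ : ∃ ρ : X → ℝ, ρ = fun x => q x * Real.exp (E₂₂ x) := ⟨_, rfl⟩
  replace hI₁₁ : Integrable ρ₁ μ := by rw [hρ₁]; exact hI₁₁
  replace hI₂₂ : Integrable ρ₂ μ := by rw [hρ₂]; exact hI₂₂
  obtain ⟨F₁₁, hF₁₁⟩ : ∃ F : ℝ, F = ∫ x, ρ₁ x ∂μ := ⟨_, rfl⟩
  obtain ⟨F₂₂, hF₂₂⟩ : ∃ F : ℝ, F = ∫ x, ρ₂ x ∂μ := ⟨_, rfl⟩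
  obtain ⟨F₁₂, hF₁₂⟩ : ∃ F : ℝ, F = ∫ x, q x * Real.exp (E₁₂ x) ∂μ := ⟨_, rfl⟩
  obtain ⟨F₂₁, hF₂₁⟩ : ∃ F : ℝ, F = ∫ x, q x * Real.exp (E₂₁ x) ∂μ := ⟨_, rfl⟩
  have eg₁ : ∫ x, q x * Real.exp (E₁₁ x) ∂μ = F₁₁ := by rw [hF₁₁, hρ₁]
  have eg₂ : ∫ x, q x * Real.exp (E₂₂ x) ∂μ = F₂₂ := by rw [hF₂₂, hρ₂]
  rw [eg₁] at hvA hvZ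
  rw [eg₂] at hvA'
  rw [eg₁, eg₂, ← hF₁₂, ← hF₂₁]
  obtain ⟨A, hA⟩ : ∃ A : X → ℝ, A = fun x => E₁₂ x - E₁₁ x := ⟨_, rfl⟩
  obtain ⟨A', hA'⟩ : ∃ A : X → ℝ, A = fun x => E₂₁ x - E₂₂ x := ⟨_, rfl⟩
  obtain ⟨Z, hZ⟩ : ∃ A : X → ℝ, A = fun x => E₂₂ x - E₁₁ x := ⟨_, rfl⟩
  obtain ⟨Q, hQ⟩ : ∃ A : X → ℝ, A = fun x => (E₁₂ x + E₂₁ x - E₁₁ x - E₂₂ x) / 2 := ⟨_, rfl⟩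
  have hρ₁0 : ∀ x, 0 ≤ ρ₁ x := fun x => by rw [hρ₁]; exact mul_nonneg (hq0 x) (Real.exp_pos _).le
  have hρ₂0 : ∀ x, 0 ≤ ρ₂ x := fun x => by rw [hρ₂]; exact mul_nonneg (hq0 x) (Real.exp_pos _).le
  have hρ₁q : ∀ x, ρ₁ x ≠ 0 → q x ≠ 0 := fun x h hq => h (by rw [hρ₁]; simp [hq])
  have hρ₂q : ∀ x, ρ₂ x ≠ 0 → q x ≠ 0 := fun x h hq => h (by rw [hρ₂]; simp [hq])
  have hmA : Measurable A := by rw [hA]; exact hm₁₂.sub hm₁₁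
  have hmA' : Measurable A' := by rw [hA']; exact hm₂₁.sub hm₂₂
  have hmZ : Measurable Z := by rw [hZ]; exact hm₂₂.sub hm₁₁
  have hmQ : Measurable Q := by rw [hQ]; exact (((hm₁₂.add hm₂₁).sub hm₁₁).sub hm₂₂).div_const 2
  -- pointwise bounds on the support
  have hbA : ∀ x, q x ≠ 0 → |A x| ≤ η := fun x hx => by rw [hA]; exact (hb x hx).1
  have hbA' : ∀ x, q x ≠ 0 → |A' x| ≤ η := fun x hx => by rw [hA']; exact (hb x hx).2.2.2.1
  have hbZ : ∀ x, q x ≠ 0 → |Z x| ≤ 2 * η := fun x hx => by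
    have h1 := (hb x hx).1; have h2 := (hb x hx).2.2.1
    have e : Z x = (E₁₂ x - E₁₁ x) - (E₁₂ x - E₂₂ x) := by rw [hZ]; ring
    rw [e]; exact (abs_sub _ _).trans (by linarith)
  have hbD : ∀ x, q x ≠ 0 → |(E₁₂ x - E₂₁ x) / 2| ≤ η := fun x hx => by
    have h1 := (hb x hx).1; have h2 := (hb x hx).2.1
    rw [abs_div, abs_two]
    have : |E₁₂ x - E₂₁ x| ≤ 2 * η := by
      have e : E₁₂ x - E₂₁ x = (E₁₂ x - E₁₁ x) - (E₂₁ x - E₁₁ x) := by ring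
      rw [e]; exact (abs_sub _ _).trans (by linarith)
    linarith
  have hbQ : ∀ x, q x ≠ 0 → |Q x| ≤ ξ / 2 := fun x hx => by
    rw [hQ]; dsimp only; rw [abs_div, abs_two]; exact div_le_div_of_nonneg_right (hb x hx).2.2.2.2 zero_le_two
  have hF₁₁0 : 0 ≤ F₁₁ := by rw [hF₁₁]; exact integral_nonneg hρ₁0
  have hF₂₂0 : 0 ≤ F₂₂ := by rw [hF₂₂]; exact integral_nonneg hρ₂0
  have hF₁₂0 : 0 ≤ F₁₂ := by rw [hF₁₂]; exact integral_nonneg fun x => mul_nonneg (hq0 x) (Real.exp_pos _).le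
  have hF₂₁0 : 0 ≤ F₂₁ := by rw [hF₂₁]; exact integral_nonneg fun x => mul_nonneg (hq0 x) (Real.exp_pos _).le
  -- comparisons of the four integrands with ρ₁, ρ₂ on the support
  have hcmp : ∀ x, q x * Real.exp (E₁₂ x) ≤ Real.exp η * ρ₁ x ∧ q x * Real.exp (E₂₁ x) ≤ Real.exp η * ρ₂ x ∧
      ρ₂ x ≤ Real.exp (2 * η) * ρ₁ x ∧ ρ₁ x ≤ Real.exp (2 * η) * ρ₂ x := fun x => by
    by_cases hx : q x = 0
    · simp [hρ₁, hρ₂, hx]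
    · have h1 := (abs_le.mp (hbA x hx)).2; have h2 := (abs_le.mp (hbA' x hx)).2
      have h3 := (abs_le.mp (hbZ x hx)).2; have h4 := (abs_le.mp (hbZ x hx)).1
      simp only [hA] at h1; simp only [hA'] at h2; simp only [hZ] at h3 h4
      simp only [hρ₁, hρ₂]
      refine ⟨?_, ?_, ?_, ?_⟩
      · rw [mul_left_comm]; refine mul_le_mul_of_nonneg_left ?_ (hq0 x)
        rw [← Real.exp_add]; exact Real.exp_le_exp.mpr (by linarith)
      · rw [mul_left_comm]; refine mul_le_mul_of_nonneg_left ?_ (hq0 x)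
        rw [← Real.exp_add]; exact Real.exp_le_exp.mpr (by linarith)
      · rw [mul_left_comm]; refine mul_le_mul_of_nonneg_left ?_ (hq0 x)
        rw [← Real.exp_add]; exact Real.exp_le_exp.mpr (by linarith)
      · rw [mul_left_comm]; refine mul_le_mul_of_nonneg_left ?_ (hq0 x)
        rw [← Real.exp_add]; exact Real.exp_le_exp.mpr (by linarith)
  have hF₁₂le : F₁₂ ≤ Real.exp η * F₁₁ := by
    rw [hF₁₂, hF₁₁, ← integral_const_mul]; exact integral_mono hI₁₂ (hI₁₁.const_mul _) fun x => (hcmp x).1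
  have hF₂₁le : F₂₁ ≤ Real.exp η * F₂₂ := by
    rw [hF₂₁, hF₂₂, ← integral_const_mul]; exact integral_mono hI₂₁ (hI₂₂.const_mul _) fun x => (hcmp x).2.1
  have hF₂₂le : F₂₂ ≤ Real.exp (2 * η) * F₁₁ := by
    rw [hF₂₂, hF₁₁, ← integral_const_mul]; exact integral_mono hI₂₂ (hI₁₁.const_mul _) fun x => (hcmp x).2.2.1
  have hF₁₁le : F₁₁ ≤ Real.exp (2 * η) * F₂₂ := by
    rw [hF₁₁, hF₂₂, ← integral_const_mul]; exact integral_mono hI₁₁ (hI₂₂.const_mul _) fun x => (hcmp x).2.2.2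
  -- degenerate case: everything vanishes
  by_cases hdeg : F₁₁ = 0 ∨ F₂₂ = 0
  · have h11 : F₁₁ = 0 := by
      rcases hdeg with h | h
      · exact h
      · exact le_antisymm (by rw [h, mul_zero] at hF₁₁le; exact hF₁₁le) hF₁₁0
    have h22 : F₂₂ = 0 := le_antisymm (by rw [h11, mul_zero] at hF₂₂le; exact hF₂₂le) hF₂₂0
    have h12 : F₁₂ = 0 := le_antisymm (by rw [h11, mul_zero] at hF₁₂le; exact hF₁₂le) hF₁₂0
    have h21 : F₂₁ = 0 := le_antisymm (by rw [h22, mul_zero] at hF₂₁le; exact hF₂₁le) hF₂₁0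
    rw [h11, h22, h12, h21]; simp
  obtain ⟨hne1, hne2⟩ := not_or.mp hdeg
  have hF₁₁p : 0 < F₁₁ := lt_of_le_of_ne hF₁₁0 (Ne.symm hne1)
  have hF₂₂p : 0 < F₂₂ := lt_of_le_of_ne hF₂₂0 (Ne.symm hne2)
  -- integrable products
  have hIA : Integrable (fun x => ρ₁ x * A x) μ := integrable_mul_of_abs_le_on_support hI₁₁ hmA fun x hx => hbA x (hρ₁q x hx)
  have hIA' : Integrable (fun x => ρ₂ x * A' x) μ := integrable_mul_of_abs_le_on_support hI₂₂ hmA' fun x hx => hbA' x (hρ₂q x hx)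
  have hIZ₁ : Integrable (fun x => ρ₁ x * Z x) μ := integrable_mul_of_abs_le_on_support hI₁₁ hmZ fun x hx => hbZ x (hρ₁q x hx)
  have hIZ₂ : Integrable (fun x => ρ₂ x * Z x) μ := integrable_mul_of_abs_le_on_support hI₂₂ hmZ fun x hx => hbZ x (hρ₂q x hx)
  have hIQ₁ : Integrable (fun x => ρ₁ x * Q x) μ := integrable_mul_of_abs_le_on_support hI₁₁ hmQ fun x hx => hbQ x (hρ₁q x hx)
  have hIQ₂ : Integrable (fun x => ρ₂ x * Q x) μ := integrable_mul_of_abs_le_on_support hI₂₂ hmQ fun x hx => hbQ x (hρ₂q x hx)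
  have hID₁ : Integrable (fun x => ρ₁ x * ((E₁₂ x - E₂₁ x) / 2)) μ :=
    integrable_mul_of_abs_le_on_support hI₁₁ ((hm₁₂.sub hm₂₁).div_const 2) fun x hx => hbD x (hρ₁q x hx)
  have hID₂ : Integrable (fun x => ρ₂ x * ((E₁₂ x - E₂₁ x) / 2)) μ :=
    integrable_mul_of_abs_le_on_support hI₂₂ ((hm₁₂.sub hm₂₁).div_const 2) fun x hx => hbD x (hρ₂q x hx)
  -- a generic bound `|∫ρφ| ≤ C∫ρ`
  have hbnd : ∀ (ρ φ : X → ℝ), (∀ x, 0 ≤ ρ x) → Integrable ρ μ → Integrable (fun x => ρ x * φ x) μ → ∀ C : ℝ, (∀ x, ρ x ≠ 0 → |φ x| ≤ C) →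
      |∫ x, ρ x * φ x ∂μ| ≤ C * ∫ x, ρ x ∂μ := by
    intro ρ φ hρ0 hρ hρφ C hC
    have hpt : ∀ x, |ρ x * φ x| ≤ C * ρ x := fun x => by
      by_cases hx : ρ x = 0
      · rw [hx]; simp
      · rw [abs_mul, abs_of_nonneg (hρ0 x), mul_comm]; exact mul_le_mul_of_nonneg_right (hC x hx) (hρ0 x)
    calc |∫ x, ρ x * φ x ∂μ| ≤ ∫ x, |ρ x * φ x| ∂μ := abs_integral_le_integral_abs
      _ ≤ ∫ x, C * ρ x ∂μ := integral_mono hρφ.abs (hρ.const_mul C) hpt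
      _ = C * ∫ x, ρ x ∂μ := integral_const_mul _ _
  -- square integrability and the moment hypotheses in `ρ`-form
  have hIA2 : Integrable (fun x => ρ₁ x * A x ^ 2) μ :=
    integrable_mul_of_abs_le_on_support hI₁₁ (hmA.pow_const 2) (C := 1) fun x hx => by
      rw [abs_pow]; have := hbA x (hρ₁q x hx); nlinarith [abs_nonneg (A x)]
  have hIA'2 : Integrable (fun x => ρ₂ x * A' x ^ 2) μ :=
    integrable_mul_of_abs_le_on_support hI₂₂ (hmA'.pow_const 2) (C := 1) fun x hx => by
      rw [abs_pow]; have := hbA' x (hρ₂q x hx); nlinarith [abs_nonneg (A' x)]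
  have hvA1 : ∫ x, ρ₁ x * A x ^ 2 ∂μ ≤ v * F₁₁ := by
    have e : (fun x => ρ₁ x * A x ^ 2) = fun x => q x * Real.exp (E₁₁ x) * (E₁₂ x - E₁₁ x) ^ 2 := by funext x; simp only [hρ₁, hA]
    rw [e]; exact hvA
  have hvA2 : ∫ x, ρ₂ x * A' x ^ 2 ∂μ ≤ v * F₂₂ := by
    have e : (fun x => ρ₂ x * A' x ^ 2) = fun x => q x * Real.exp (E₂₂ x) * (E₂₁ x - E₂₂ x) ^ 2 := by funext x; simp only [hρ₂, hA']
    rw [e]; exact hvA'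
  have hvZ1 : ∫ x, ρ₁ x * Z x ^ 2 ∂μ ≤ v * F₁₁ := by
    have e : (fun x => ρ₁ x * Z x ^ 2) = fun x => q x * Real.exp (E₁₁ x) * (E₂₂ x - E₁₁ x) ^ 2 := by funext x; simp only [hρ₁, hZ]
    rw [e]; exact hvZ
  -- Step 1: `e^A = 1 + A + [0, A²]`
  obtain ⟨IA, hIA_def⟩ : ∃ I : ℝ, I = ∫ x, ρ₁ x * A x ∂μ := ⟨_, rfl⟩
  obtain ⟨IA', hIA'_def⟩ : ∃ I : ℝ, I = ∫ x, ρ₂ x * A' x ∂μ := ⟨_, rfl⟩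
  have hR₁ : 0 ≤ F₁₂ - F₁₁ - IA ∧ F₁₂ - F₁₁ - IA ≤ v * F₁₁ := by
    have hIAq : Integrable (fun x => q x * Real.exp (E₁₁ x) * A x) μ := by rw [hρ₁] at hIA; exact hIA
    have hIA2q : Integrable (fun x => q x * Real.exp (E₁₁ x) * A x ^ 2) μ := by rw [hρ₁] at hIA2; exact hIA2
    have h := exp_moment_first_order_var (μ := μ) hq0 hA (by rw [hρ₁] at hI₁₁; exact hI₁₁) hI₁₂ hIAq hIA2q fun x hx => (hbA x hx).trans hη1
    rw [eg₁, ← hF₁₂] at h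
    have e : ∫ x, q x * Real.exp (E₁₁ x) * A x ∂μ = IA := by rw [hIA_def, hρ₁]
    have e2 : ∫ x, q x * Real.exp (E₁₁ x) * A x ^ 2 ∂μ = ∫ x, ρ₁ x * A x ^ 2 ∂μ := by rw [hρ₁]
    rw [e, e2] at h; exact ⟨h.1, h.2.trans hvA1⟩
  have hR₂ : 0 ≤ F₂₁ - F₂₂ - IA' ∧ F₂₁ - F₂₂ - IA' ≤ v * F₂₂ := by
    have hIAq : Integrable (fun x => q x * Real.exp (E₂₂ x) * A' x) μ := by rw [hρ₂] at hIA'; exact hIA'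
    have hIA2q : Integrable (fun x => q x * Real.exp (E₂₂ x) * A' x ^ 2) μ := by rw [hρ₂] at hIA'2; exact hIA'2
    have h := exp_moment_first_order_var (μ := μ) hq0 hA' (by rw [hρ₂] at hI₂₂; exact hI₂₂) hI₂₁ hIAq hIA2q fun x hx => (hbA' x hx).trans hη1
    rw [eg₂, ← hF₂₁] at h
    have e : ∫ x, q x * Real.exp (E₂₂ x) * A' x ∂μ = IA' := by rw [hIA'_def, hρ₂]
    have e2 : ∫ x, q x * Real.exp (E₂₂ x) * A' x ^ 2 ∂μ = ∫ x, ρ₂ x * A' x ^ 2 ∂μ := by rw [hρ₂]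
    rw [e, e2] at h; exact ⟨h.1, h.2.trans hvA2⟩
  -- Step 2: the symmetry — `IA = IQ₁ + ½IZ₁`, `IA' = IQ₂ − ½IZ₂`
  obtain ⟨IQ₁, hIQ₁_def⟩ : ∃ I : ℝ, I = ∫ x, ρ₁ x * Q x ∂μ := ⟨_, rfl⟩
  obtain ⟨IQ₂, hIQ₂_def⟩ : ∃ I : ℝ, I = ∫ x, ρ₂ x * Q x ∂μ := ⟨_, rfl⟩
  obtain ⟨IZ₁, hIZ₁_def⟩ : ∃ I : ℝ, I = ∫ x, ρ₁ x * Z x ∂μ := ⟨_, rfl⟩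
  obtain ⟨IZ₂, hIZ₂_def⟩ : ∃ I : ℝ, I = ∫ x, ρ₂ x * Z x ∂μ := ⟨_, rfl⟩
  have hS₁' : ∫ x, ρ₁ x * ((E₁₂ x - E₂₁ x) / 2) ∂μ = 0 := by
    have : (fun x => ρ₁ x * ((E₁₂ x - E₂₁ x) / 2)) = fun x => (1 / 2 : ℝ) * (q x * Real.exp (E₁₁ x) * (E₁₂ x - E₂₁ x)) := by
      funext x; simp only [hρ₁]; ring
    rw [this, integral_const_mul, hS₁, mul_zero]
  have hS₂' : ∫ x, ρ₂ x * ((E₁₂ x - E₂₁ x) / 2) ∂μ = 0 := by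
    have : (fun x => ρ₂ x * ((E₁₂ x - E₂₁ x) / 2)) = fun x => (1 / 2 : ℝ) * (q x * Real.exp (E₂₂ x) * (E₁₂ x - E₂₁ x)) := by
      funext x; simp only [hρ₂]; ring
    rw [this, integral_const_mul, hS₂, mul_zero]
  have eh₁ : (fun x => ρ₁ x * (Z x / 2)) = fun x => ρ₁ x * Z x / 2 := by funext x; ring
  have eh₂ : (fun x => ρ₂ x * (Z x / 2)) = fun x => ρ₂ x * Z x / 2 := by funext x; ring
  have hIZh₁ : Integrable (fun x => ρ₁ x * (Z x / 2)) μ := by rw [eh₁]; exact hIZ₁.div_const 2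
  have hIZh₂ : Integrable (fun x => ρ₂ x * (Z x / 2)) μ := by rw [eh₂]; exact hIZ₂.div_const 2
  have hZh₁ : ∫ x, ρ₁ x * (Z x / 2) ∂μ = IZ₁ / 2 := by rw [eh₁, integral_div, hIZ₁_def]
  have hZh₂ : ∫ x, ρ₂ x * (Z x / 2) ∂μ = IZ₂ / 2 := by rw [eh₂, integral_div, hIZ₂_def]
  have hIA_eq : IA = IQ₁ + IZ₁ / 2 := by
    -- `A = Q + Z/2 + (E₁₂ − E₂₁)/2`
    have e : (fun x => ρ₁ x * A x) = fun x => (ρ₁ x * Q x + ρ₁ x * (Z x / 2)) + ρ₁ x * ((E₁₂ x - E₂₁ x) / 2) := by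
      funext x; simp only [hA, hQ, hZ]; ring
    have hs : Integrable (fun x => ρ₁ x * Q x + ρ₁ x * (Z x / 2)) μ := hIQ₁.add hIZh₁
    rw [hIA_def, e, integral_add hs hID₁, hS₁', add_zero, integral_add hIQ₁ hIZh₁, hZh₁, hIQ₁_def]
  have hIA'_eq : IA' = IQ₂ - IZ₂ / 2 := by
    have e : (fun x => ρ₂ x * A' x) = fun x => (ρ₂ x * Q x - ρ₂ x * (Z x / 2)) - ρ₂ x * ((E₁₂ x - E₂₁ x) / 2) := by
      funext x; simp only [hA', hQ, hZ]; ring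
    have hs : Integrable (fun x => ρ₂ x * Q x - ρ₂ x * (Z x / 2)) μ := hIQ₂.sub hIZh₂
    rw [hIA'_def, e, integral_sub hs hID₂, hS₂', sub_zero, integral_sub hIQ₂ hIZh₂, hZh₂, hIQ₂_def]
  -- Step 3: first-moment bounds
  have hIQ₁b : |IQ₁| ≤ ξ / 2 * F₁₁ := by rw [hIQ₁_def, hF₁₁]; exact hbnd ρ₁ Q hρ₁0 hI₁₁ hIQ₁ _ fun x hx => hbQ x (hρ₁q x hx)
  have hIQ₂b : |IQ₂| ≤ ξ / 2 * F₂₂ := by rw [hIQ₂_def, hF₂₂]; exact hbnd ρ₂ Q hρ₂0 hI₂₂ hIQ₂ _ fun x hx => hbQ x (hρ₂q x hx)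
  -- Cauchy–Schwarz: `|IA| ≤ √v·F₁₁`, `|IA'| ≤ √v·F₂₂`
  obtain ⟨s, hsdef⟩ : ∃ s : ℝ, s = Real.sqrt v := ⟨_, rfl⟩
  have hs0 : 0 ≤ s := by rw [hsdef]; exact Real.sqrt_nonneg _
  have hs1 : s ≤ 1 := by rw [hsdef]; exact Real.sqrt_le_one.mpr hv1
  have hss : s * s = v := by rw [hsdef]; exact Real.mul_self_sqrt hv0
  have hvs : v ≤ s := by nlinarith
  have hIAb : |IA| ≤ s * F₁₁ := by
    have h := sq_integral_mul_le (μ := μ) hρ₁0 hI₁₁ hIA hIA2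
    rw [← hIA_def, ← hF₁₁] at h
    have h2 : IA ^ 2 ≤ v * F₁₁ ^ 2 := by nlinarith [h, hvA1, hF₁₁0]
    calc |IA| ≤ Real.sqrt (v * F₁₁ ^ 2) := Real.abs_le_sqrt h2
      _ = s * F₁₁ := by rw [Real.sqrt_mul hv0, Real.sqrt_sq hF₁₁0, hsdef]
  have hIA'b : |IA'| ≤ s * F₂₂ := by
    have h := sq_integral_mul_le (μ := μ) hρ₂0 hI₂₂ hIA' hIA'2
    rw [← hIA'_def, ← hF₂₂] at h
    have h2 : IA' ^ 2 ≤ v * F₂₂ ^ 2 := by nlinarith [h, hvA2, hF₂₂0]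
    calc |IA'| ≤ Real.sqrt (v * F₂₂ ^ 2) := Real.abs_le_sqrt h2
      _ = s * F₂₂ := by rw [Real.sqrt_mul hv0, Real.sqrt_sq hF₂₂0, hsdef]
  -- Step 4: monotone covariance — `0 ≤ F₁₁·IZ₂ − F₂₂·IZ₁ ≤ 4η²e^{2η}F₁₁²` (`ρ₂ = ρ₁e^{Z}`)
  have hρ₂Z : ∀ x, ρ₂ x = ρ₁ x * Real.exp (Z x) := fun x => by
    simp only [hρ₁, hρ₂, hZ]; rw [mul_assoc, ← Real.exp_add]; ring_nf
  have hcov : 0 ≤ F₁₁ * IZ₂ - F₂₂ * IZ₁ ∧ F₁₁ * IZ₂ - F₂₂ * IZ₁ ≤ Real.exp (2 * η) * F₁₁ * (v * F₁₁) := by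
    have hIe : Integrable (fun x => ρ₁ x * Real.exp (Z x)) μ := by
      have : (fun x => ρ₁ x * Real.exp (Z x)) = ρ₂ := by funext x; rw [hρ₂Z x]
      rw [this]; exact hI₂₂
    have h := exp_tilt_covariance_var (μ := μ) hρ₁0 hI₁₁ hmZ hIe (c := 2 * η) fun x hx => hbZ x (hρ₁q x hx)
    have e1 : ∫ x, ρ₁ x * Real.exp (Z x) * Z x ∂μ = IZ₂ := by
      rw [hIZ₂_def]; exact integral_congr_ae (ae_of_all _ fun x => by dsimp only; rw [hρ₂Z x])
    have e2 : ∫ x, ρ₁ x * Real.exp (Z x) ∂μ = F₂₂ := by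
      rw [hF₂₂]; exact integral_congr_ae (ae_of_all _ fun x => by dsimp only; rw [hρ₂Z x])
    rw [e1, e2, ← hF₁₁, ← hIZ₁_def] at h
    exact ⟨h.1, h.2.trans (mul_le_mul_of_nonneg_left hvZ1 (by positivity))⟩
  -- Step 5: assembly
  have he4 : Real.exp (2 * η) * Real.exp (2 * η) ≤ 55 := by
    have h4 : Real.exp 4 ≤ 55 := by
      have e : Real.exp 1 ^ 4 = Real.exp 4 := by rw [Real.exp_one_pow]; norm_num
      rw [← e]
      exact (pow_le_pow_left₀ (Real.exp_pos 1).le Real.exp_one_lt_d9.le 4).trans (by norm_num)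
    rw [← Real.exp_add]; exact (Real.exp_le_exp.mpr (by linarith)).trans h4
  -- the first-order terms: `F₂₂·IA + F₁₁·IA' = F₂₂IQ₁ + F₁₁IQ₂ − ½(F₁₁IZ₂ − F₂₂IZ₁)`
  have hfirst : |F₂₂ * IA + F₁₁ * IA'| ≤ ξ * (F₁₁ * F₂₂) + 28 * v * (F₁₁ * F₂₂) := by
    rw [hIA_eq, hIA'_eq]
    have e : F₂₂ * (IQ₁ + IZ₁ / 2) + F₁₁ * (IQ₂ - IZ₂ / 2) = (F₂₂ * IQ₁ + F₁₁ * IQ₂) - (F₁₁ * IZ₂ - F₂₂ * IZ₁) / 2 := by ring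
    rw [e]
    have h1 : |F₂₂ * IQ₁ + F₁₁ * IQ₂| ≤ ξ * (F₁₁ * F₂₂) := by
      refine (abs_add_le _ _).trans ?_
      rw [abs_mul, abs_mul, abs_of_pos hF₂₂p, abs_of_pos hF₁₁p]
      have k1 := mul_le_mul_of_nonneg_left hIQ₁b hF₂₂0
      have k2 := mul_le_mul_of_nonneg_left hIQ₂b hF₁₁0
      have e2 : F₂₂ * (ξ / 2 * F₁₁) + F₁₁ * (ξ / 2 * F₂₂) = ξ * (F₁₁ * F₂₂) := by ring
      linarith [k1, k2, e2]
    have h3 : Real.exp (2 * η) * F₁₁ ^ 2 ≤ 55 * (F₁₁ * F₂₂) := by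
      calc Real.exp (2 * η) * F₁₁ ^ 2 = Real.exp (2 * η) * F₁₁ * F₁₁ := by ring
        _ ≤ Real.exp (2 * η) * F₁₁ * (Real.exp (2 * η) * F₂₂) := mul_le_mul_of_nonneg_left hF₁₁le (by positivity)
        _ = (Real.exp (2 * η) * Real.exp (2 * η)) * (F₁₁ * F₂₂) := by ring
        _ ≤ 55 * (F₁₁ * F₂₂) := mul_le_mul_of_nonneg_right he4 (by positivity)
    have h2 : |(F₁₁ * IZ₂ - F₂₂ * IZ₁) / 2| ≤ 28 * v * (F₁₁ * F₂₂) := by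
      rw [abs_of_nonneg (by linarith [hcov.1])]
      have k : v * (Real.exp (2 * η) * F₁₁ ^ 2) ≤ v * (55 * (F₁₁ * F₂₂)) := mul_le_mul_of_nonneg_left h3 hv0
      have k' : F₁₁ * IZ₂ - F₂₂ * IZ₁ ≤ v * (Real.exp (2 * η) * F₁₁ ^ 2) := by
        calc F₁₁ * IZ₂ - F₂₂ * IZ₁ ≤ _ := hcov.2
          _ = v * (Real.exp (2 * η) * F₁₁ ^ 2) := by ring
      have hP : 0 ≤ v * (F₁₁ * F₂₂) := mul_nonneg hv0 (mul_nonneg hF₁₁0 hF₂₂0)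
      have e6 : v * (55 * (F₁₁ * F₂₂)) = 55 * (v * (F₁₁ * F₂₂)) := by ring
      have e7 : 28 * v * (F₁₁ * F₂₂) = 28 * (v * (F₁₁ * F₂₂)) := by ring
      rw [e7]
      linarith [k, k', e6]
    calc |F₂₂ * IQ₁ + F₁₁ * IQ₂ - (F₁₁ * IZ₂ - F₂₂ * IZ₁) / 2| ≤ |F₂₂ * IQ₁ + F₁₁ * IQ₂| + |(F₁₁ * IZ₂ - F₂₂ * IZ₁) / 2| := abs_sub _ _
      _ ≤ _ := add_le_add h1 h2
  -- `F₁₂ = F₁₁ + IA + r₁`, `F₂₁ = F₂₂ + IA' + r₂`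
  obtain ⟨r₁, hr₁⟩ : ∃ r : ℝ, r = F₁₂ - F₁₁ - IA := ⟨_, rfl⟩
  obtain ⟨r₂, hr₂⟩ : ∃ r : ℝ, r = F₂₁ - F₂₂ - IA' := ⟨_, rfl⟩
  rw [← hr₁] at hR₁
  rw [← hr₂] at hR₂
  have hexp : F₁₂ * F₂₁ - F₁₁ * F₂₂ = (F₂₂ * IA + F₁₁ * IA') + (F₂₂ * r₁ + F₁₁ * r₂) + (IA + r₁) * (IA' + r₂) := by
    rw [hr₁, hr₂]; ring
  rw [hexp]
  have hvF₁ : v * F₁₁ ≤ s * F₁₁ := mul_le_mul_of_nonneg_right hvs hF₁₁0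
  have hvF₂ : v * F₂₂ ≤ s * F₂₂ := mul_le_mul_of_nonneg_right hvs hF₂₂0
  have hx1 : |IA + r₁| ≤ 2 * s * F₁₁ := by
    refine (abs_add_le _ _).trans ?_
    rw [abs_of_nonneg hR₁.1]
    linarith [hIAb, hR₁.2]
  have hx2 : |IA' + r₂| ≤ 2 * s * F₂₂ := by
    refine (abs_add_le _ _).trans ?_
    rw [abs_of_nonneg hR₂.1]
    linarith [hIA'b, hR₂.2]
  have hprod : |(IA + r₁) * (IA' + r₂)| ≤ 4 * v * (F₁₁ * F₂₂) := by
    rw [abs_mul]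
    calc |IA + r₁| * |IA' + r₂| ≤ (2 * s * F₁₁) * (2 * s * F₂₂) := mul_le_mul hx1 hx2 (abs_nonneg _) (by positivity)
      _ = 4 * (s * s) * (F₁₁ * F₂₂) := by ring
      _ = 4 * v * (F₁₁ * F₂₂) := by rw [hss]
  have hrem : |F₂₂ * r₁ + F₁₁ * r₂| ≤ 2 * v * (F₁₁ * F₂₂) := by
    have k1 := mul_le_mul_of_nonneg_left hR₁.2 hF₂₂0
    have k2 := mul_le_mul_of_nonneg_left hR₂.2 hF₁₁0
    have k3 := mul_nonneg hF₂₂0 hR₁.1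
    have k4 := mul_nonneg hF₁₁0 hR₂.1
    have e2 : F₂₂ * (v * F₁₁) + F₁₁ * (v * F₂₂) = 2 * v * (F₁₁ * F₂₂) := by ring
    rw [abs_of_nonneg (by linarith)]
    linarith [k1, k2, e2]
  have hP : 0 ≤ v * (F₁₁ * F₂₂) := mul_nonneg hv0 (mul_nonneg hF₁₁0 hF₂₂0)
  have hsum := abs_add_le (F₂₂ * IA + F₁₁ * IA') (F₂₂ * r₁ + F₁₁ * r₂)
  have hsum2 := abs_add_le (F₂₂ * IA + F₁₁ * IA' + (F₂₂ * r₁ + F₁₁ * r₂)) ((IA + r₁) * (IA' + r₂))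
  have e3 : (ξ + 40 * v) * (F₁₁ * F₂₂) = ξ * (F₁₁ * F₂₂) + 40 * (v * (F₁₁ * F₂₂)) := by ring
  rw [e3]
  linarith [hfirst, hrem, hprod, hsum, hsum2, hP]

end Summit.QuantumFields.YangMills.Theorems.FemtoTransferGap.RateTube

end
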